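import Summits.MatrixMultiplication.OmegaCensus.SmallFormats.MatMul22nRankGF7Slack5Search
import HarnessLib

/-!
# ω-census family (a): replay of the slack-5 search certificate, CHECK A part 6 of 12 (elements `140 ≤ h < 168`)

Cell `pub-omega` (unit `pub-omega-tensor-g16`), topic `Summits/MatrixMultiplication/OmegaCensus` (sub-folder `SmallFormats`).
Framing (verbatim): lottery ticket; floor = certified bounds/negative ranges. HONEST FRAMING: machine-generated kernel replay
(`pub-omega-tensor-g16/code/gen5_runs.py`): `levelsOK5n h = true` for the elements `140 ≤ h < 168` of `PGL₂(7)`: for every slot `(c, h)`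
(`c < 656`) and bucket level, if the key of its column is visited then the bucket holds an entry with that column (SIMD key planes,
`MatMul22nRankGF7Plane`). Meaning: `slotOK5_of_levelsOK5` (`MatMul22nRankGF7Slack5SearchSound`). Nothing here is progress on `ω`.
-/

namespace Summit.MatrixMultiplication.OmegaCensus.SmallFormats

set_option Elab.async false

set_option maxRecDepth 100000 in
set_option maxHeartbeats 400000000 in
/-- Elements `140 ≤ h < 144`. -/
theorem levelsOK5_ok_140_144 : ∀ h : Fin 336, 140 ≤ h.val → h.val < 144 → levelsOK5n h.val = true := by decide +kernel

set_option maxRecDepth 100000 in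
set_option maxHeartbeats 400000000 in
/-- Elements `144 ≤ h < 148`. -/
theorem levelsOK5_ok_144_148 : ∀ h : Fin 336, 144 ≤ h.val → h.val < 148 → levelsOK5n h.val = true := by decide +kernel

set_option maxRecDepth 100000 in
set_option maxHeartbeats 400000000 in
/-- Elements `148 ≤ h < 152`. -/
theorem levelsOK5_ok_148_152 : ∀ h : Fin 336, 148 ≤ h.val → h.val < 152 → levelsOK5n h.val = true := by decide +kernel

set_option maxRecDepth 100000 in
set_option maxHeartbeats 400000000 in
/-- Elements `152 ≤ h < 156`. -/
theorem levelsOK5_ok_152_156 : ∀ h : Fin 336, 152 ≤ h.val → h.val < 156 → levelsOK5n h.val = true := by decide +kernel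

set_option maxRecDepth 100000 in
set_option maxHeartbeats 400000000 in
/-- Elements `156 ≤ h < 160`. -/
theorem levelsOK5_ok_156_160 : ∀ h : Fin 336, 156 ≤ h.val → h.val < 160 → levelsOK5n h.val = true := by decide +kernel

set_option maxRecDepth 100000 in
set_option maxHeartbeats 400000000 in
/-- Elements `160 ≤ h < 164`. -/
theorem levelsOK5_ok_160_164 : ∀ h : Fin 336, 160 ≤ h.val → h.val < 164 → levelsOK5n h.val = true := by decide +kernel

set_option maxRecDepth 100000 in
set_option maxHeartbeats 400000000 in
/-- Elements `164 ≤ h < 168`. -/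
theorem levelsOK5_ok_164_168 : ∀ h : Fin 336, 164 ≤ h.val → h.val < 168 → levelsOK5n h.val = true := by decide +kernel

/-- CHECK A for the elements `140 ≤ h < 168`. -/
theorem levelsOK5_run_6 : ∀ h : Fin 336, 140 ≤ h.val → h.val < 168 → levelsOK5n h.val = true := by
  intro h hlo hhi
  by_cases h144 : h.val < 144
  · exact levelsOK5_ok_140_144 h (by omega) h144
  by_cases h148 : h.val < 148
  · exact levelsOK5_ok_144_148 h (by omega) h148
  by_cases h152 : h.val < 152
  · exact levelsOK5_ok_148_152 h (by omega) h152
  by_cases h156 : h.val < 156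
  · exact levelsOK5_ok_152_156 h (by omega) h156
  by_cases h160 : h.val < 160
  · exact levelsOK5_ok_156_160 h (by omega) h160
  by_cases h164 : h.val < 164
  · exact levelsOK5_ok_160_164 h (by omega) h164
  exact levelsOK5_ok_164_168 h (by omega) hhi

end Summit.MatrixMultiplication.OmegaCensus.SmallFormats
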